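import Mathlib
import Summits.MatrixMultiplication.Statement
import Summits.MatrixMultiplication.MatrixMultiplication.Theorems.GraphEquationsPivotDesignGrowth
import Summits.MatrixMultiplication.MatrixMultiplication.Theorems.GraphEquationsPivotDesignKernel

/-!
# Horizontal derivation unmasks: ONE base-direction derivative vs `|P|` generators (`GraphEquations`, M57)

Decomp-mm node «GraphEquations» (lens 5, g42); attacked leaf `MultiplicityReduction`
(stmt-MatrixMultiplication-27806).  Target VERBATIM: `_root_.MatrixMultiplication`.  Route-neutral.

The HORIZONTAL field along a base direction `(U,V)` is
`X_{U,V} = Σ u_{ik} ∂/∂a_{ik} + Σ v_{kj} ∂/∂b_{kj} + Σ (UB + AV)_{il} ∂/∂c_{il}`: it KILLS EVERY GENERATOR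
`f_q = c_q − (AB)_q`, hence maps the graph ideal into itself (the cell's horizontal fields of M20c are
the coordinate cases), and forward AD along it costs `× 3` nonscalar (M20c) / `≤ 4·cost + cost(UB+AV)`
gates (M15d).  On an AFFINE test `g = ⟨κ + L_A A + L_B B + M C, f⟩` it acts in closed form:

* `AffTest.hderiv g U V = ⟨L_A U + L_B V, M ∘ (· V), M ∘ (U ·), 0⟩` — again affine, with NO quadratic part;
  `jac_hderiv` + `jac_add_add` (exact Taylor formula of the row map, quadratic in the base) certify that
  its `C`-gradient is the first variation of `J_g` along `(U,V)`; `hderiv_hderiv` — the second horizontal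
  derivative is a GENERATOR COMBINATION `⟨M(UV′ + U′V), f⟩`; the third vanishes.
* `Correct.eq_zero_of_isKer_hclosed₂` — POINTWISE RIGIDITY: a kernel vector at `(A,B)` orthogonal to the
  rows of all second horizontal derivatives is a common left kernel vector of the quadratic parts, hence
  `0` for a correct system (`Correct.not_isKer_of_common_left_ker`, M40): the full horizontal closure of a
  correct affine system is reduced EVERYWHERE; `Correct.eq_zero_of_isKer_hclosed₁` — without `A`-linear
  parts the FIRST derivatives along `(U,0)` already suffice off `det B = 0` (depth `≥ 2` at a generic base
  point needs the linear/quadratic coupling `L_Aᵀδ = −mat(Mᵀδ)Bᵀ`, NODE-g42 §3).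
* **`PivotDesign.reducedAt_happend_id`** — for EVERY pivot design (M54; corank `|P|` identically, up to
  `≥ n^{3/2}/4`, M55/M56) ONE horizontal derivative along the FREE direction `(𝟙, 0)` (`UB + AV = B`: no
  product) appended to the system makes it REDUCED AT EVERY BASE POINT (`happend_id_correct`: still
  correct), whereas by generators `|P|` appended tests are necessary (M56 `card_piv_le_length_of_unmask`):
  `horizontal_vs_generators`.  Corank was the wrong currency; HORIZONTAL DEPTH (number of derivation
  rounds to generic reducedness; `1` for all designs, `≤` generic corank in general — NODE-g42 §3) is the
  dial that feeds `CubicUnmask`/CEFM at cost `3^{depth}`.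
Sources: [BurgisserClausenShokrollahi1997, §4.1 Rem. (4.3), (7.7), Problem 16.3];
[LeykinVerscheldeZhao2006, Thm. 3.1]; the cell's M20c/M40/M54–M56.  No `sorry`.
-/

-- dupNamespace: forced by the nested Summit.MatrixMultiplication.MatrixMultiplication layout (D-0017)
set_option linter.dupNamespace false

noncomputable section

namespace Summit.MatrixMultiplication.MatrixMultiplication.Theorems.GraphEquations

open Matrix Module

variable {n : ℕ}

/-! ## Left and right multiplication as operators on `ℂ^{n×n}` -/

/-- `B ↦ UB` as an operator. -/
def lmulOp (U : Vec n) : SqMat n := Matrix.of fun p v => if v.2 = p.2 then U (p.1, v.1) else 0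

/-- `lmulOp U` is left multiplication by `U`. -/
theorem lmulOp_mulVec (U B : Vec n) : lmulOp U *ᵥ B = prodVec U B := by
  ext p
  rw [show prodVec U B p = ∑ k, U (p.1, k) * B (k, p.2) from rfl]
  simp only [mulVec, dotProduct, lmulOp, Matrix.of_apply, ite_mul, zero_mul]
  rw [Fintype.sum_prod_type]
  exact Finset.sum_congr rfl fun k _ => by rw [Finset.sum_ite_eq']; simp

/-- `A ↦ AV` as an operator. -/
def rmulOp (V : Vec n) : SqMat n := Matrix.of fun p v => if v.1 = p.1 then V (v.2, p.2) else 0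

/-- `rmulOp V` is right multiplication by `V`. -/
theorem rmulOp_mulVec (V A : Vec n) : rmulOp V *ᵥ A = prodVec A V := by
  ext p
  rw [show prodVec A V p = ∑ k, A (p.1, k) * V (k, p.2) from rfl]
  simp only [mulVec, dotProduct, rmulOp, Matrix.of_apply, ite_mul, zero_mul]
  rw [Fintype.sum_prod_type, Finset.sum_comm]
  refine Finset.sum_congr rfl fun k _ => ?_
  rw [Finset.sum_ite_eq']
  simp [mul_comm]

/-- Bilinearity of the product: `(A+U)(B+V) = AB + UB + AV + UV`. -/
theorem prodVec_add_add (A U B V : Vec n) :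
    prodVec (A + U) (B + V) = prodVec A B + prodVec U B + prodVec A V + prodVec U V := by
  funext p
  simp only [Pi.add_apply]
  rw [show prodVec (A + U) (B + V) p = ∑ k, (A + U) (p.1, k) * (B + V) (k, p.2) from rfl,
    show prodVec A B p = ∑ k, A (p.1, k) * B (k, p.2) from rfl,
    show prodVec U B p = ∑ k, U (p.1, k) * B (k, p.2) from rfl,
    show prodVec A V p = ∑ k, A (p.1, k) * V (k, p.2) from rfl,
    show prodVec U V p = ∑ k, U (p.1, k) * V (k, p.2) from rfl,
    ← Finset.sum_add_distrib, ← Finset.sum_add_distrib, ← Finset.sum_add_distrib]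
  exact Finset.sum_congr rfl fun k _ => by simp only [Pi.add_apply]; ring

/-- `E_{(a,b)} · E_{(b,c)} = E_{(a,c)}`. -/
theorem prodVec_single_single (a b c : Fin n) :
    prodVec (Pi.single (a, b) (1 : ℂ)) (Pi.single (b, c) 1) = Pi.single (a, c) 1 := by
  funext p
  rw [show prodVec (Pi.single (a, b) (1 : ℂ)) (Pi.single (b, c) 1) p =
      ∑ k, (Pi.single (a, b) (1 : ℂ) : Vec n) (p.1, k) * (Pi.single (b, c) (1 : ℂ) : Vec n) (k, p.2)
      from rfl]
  rw [Finset.sum_eq_single b]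
  · by_cases hp : p = (a, c)
    · subst hp; simp
    · rw [Pi.single_eq_of_ne hp]
      by_cases h1 : p.1 = a
      · have h2 : p.2 ≠ c := fun h2 => hp (Prod.ext h1 h2)
        have : ((b, p.2) : Fin n × Fin n) ≠ (b, c) := fun h => h2 (congrArg Prod.snd h)
        rw [Pi.single_eq_of_ne this, mul_zero]
      · have : ((p.1, b) : Fin n × Fin n) ≠ (a, b) := fun h => h1 (congrArg Prod.fst h)
        rw [Pi.single_eq_of_ne this, zero_mul]
  · intro k _ hk
    have : ((p.1, k) : Fin n × Fin n) ≠ (a, b) := fun h => hk (congrArg Prod.snd h)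
    rw [Pi.single_eq_of_ne this, zero_mul]
  · intro h; exact absurd (Finset.mem_univ b) h

/-! ## The horizontal derivative of an affine test -/

namespace AffTest

variable (g : AffTest n) (U V : Vec n)

/-- **Horizontal derivative** of `g = ⟨κ + L_A A + L_B B + M C, f⟩` along the base direction `(U,V)`:
the field `X_{U,V}` kills `f` and differentiates the coefficient vector, giving the affine test
`⟨L_A U + L_B V + M(UB + AV), f⟩` — constant part `L_A U + L_B V`, `A`-part `M(·V)`, `B`-part `M(U·)`,
NO `C`-part. -/
def hderiv : AffTest n := ⟨g.LA *ᵥ U + g.LB *ᵥ V, g.M * rmulOp V, g.M * lmulOp U, 0⟩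

/-- A horizontal derivative has no quadratic part. -/
theorem hderiv_M : (g.hderiv U V).M = 0 := rfl

/-- Its coefficient vector: `L_A U + L_B V + M(UB + AV)` (independent of `C`). -/
theorem coef_hderiv (A B C : Vec n) :
    (g.hderiv U V).coef A B C = g.LA *ᵥ U + g.LB *ᵥ V + g.M *ᵥ (prodVec U B + prodVec A V) := by
  simp only [hderiv, coef, ← mulVec_mulVec, rmulOp_mulVec, lmulOp_mulVec, zero_mulVec, add_zero,
    mulVec_add]
  abel

/-- Its `C`-gradient on the graph. -/
theorem jac_hderiv (A B : Vec n) :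
    (g.hderiv U V).jac A B = g.LA *ᵥ U + g.LB *ᵥ V + g.M *ᵥ (prodVec U B + prodVec A V) :=
  g.coef_hderiv U V A B _

/-- **Exact Taylor formula of the row map** (quadratic in the base): `J_g(A+U, B+V) =
J_g(A,B) + J_{∂g}(A,B) + M(UV)` — the gradient of the horizontal derivative IS the first variation of
the gradient of `g` along `(U,V)`. -/
theorem jac_add_add (A B : Vec n) :
    g.jac (A + U) (B + V) = g.jac A B + (g.hderiv U V).jac A B + g.M *ᵥ prodVec U V := by
  rw [jac_eq, jac_eq, jac_hderiv, prodVec_add_add]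
  simp only [mulVec_add]
  abel

/-- **The second horizontal derivative is a generator combination** `⟨M(UV′ + U′V), f⟩`. -/
theorem hderiv_hderiv (U' V' : Vec n) :
    (g.hderiv U V).hderiv U' V' = ⟨g.M *ᵥ (prodVec U V' + prodVec U' V), 0, 0, 0⟩ := by
  simp only [hderiv, Matrix.zero_mul, ← mulVec_mulVec, rmulOp_mulVec, lmulOp_mulVec, ← mulVec_add,
    add_comm]

/-- The third horizontal derivative vanishes. -/
theorem hderiv_hderiv_hderiv (U' V' U'' V'' : Vec n) :
    ((g.hderiv U V).hderiv U' V').hderiv U'' V'' = ⟨0, 0, 0, 0⟩ := by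
  rw [hderiv_hderiv]
  simp [hderiv]

/-- Gradient of the second horizontal derivative: the constant row `M(UV′ + U′V)`. -/
theorem jac_hderiv_hderiv (U' V' A B : Vec n) :
    ((g.hderiv U V).hderiv U' V').jac A B = g.M *ᵥ (prodVec U V' + prodVec U' V) := by
  rw [hderiv_hderiv]
  simp [jac_eq]

variable {g}

/-- **Pointwise rigidity, the algebraic core.**  A vector orthogonal to the rows of ALL second
horizontal derivatives of `g` is a left kernel vector of its quadratic part. -/
theorem vecMul_M_eq_zero_of_hderiv₂ {A B δ : Vec n}
    (h : ∀ U V U' V', ((g.hderiv U V).hderiv U' V').jac A B ⬝ᵥ δ = 0) : δ ᵥ* g.M = 0 := by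
  funext q
  have h1 := h (Pi.single (q.1, q.1) 1) 0 0 (Pi.single (q.1, q.2) 1)
  rw [jac_hderiv_hderiv, prodVec_zero_left, add_zero, prodVec_single_single, Prod.mk.eta,
    dotProduct_comm, dotProduct_mulVec] at h1
  have h2 : (δ ᵥ* g.M) ⬝ᵥ Pi.single q (1 : ℂ) = (δ ᵥ* g.M) q := by
    rw [dotProduct_comm, single_dotProduct, one_mul]
  rw [h2] at h1
  exact h1

/-- **First-order closure already suffices without an `A`-linear part.**  If `L_A = 0`, `B` is
invertible (`U ↦ UB` onto) and `δ` is orthogonal to the rows of the FIRST horizontal derivatives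
along the `A`-directions `(U,0)`, then `δ` is a left kernel vector of the quadratic part: horizontal
depth `≥ 2` at a generic base point needs the coupling of linear and quadratic parts. -/
theorem vecMul_M_eq_zero_of_hderiv₁ {A B δ : Vec n} (hLA : g.LA = 0)
    (hB : Function.Surjective fun U : Vec n => prodVec U B)
    (h : ∀ U, (g.hderiv U 0).jac A B ⬝ᵥ δ = 0) : δ ᵥ* g.M = 0 := by
  funext q
  obtain ⟨U, hU⟩ := hB (Pi.single q 1)
  have hU' : prodVec U B = Pi.single q 1 := hU
  have h1 := h U
  rw [jac_hderiv, hLA, zero_mulVec, mulVec_zero, zero_add, zero_add, prodVec_zero_right, add_zero,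
    hU', dotProduct_comm, dotProduct_mulVec] at h1
  have h2 : (δ ᵥ* g.M) ⬝ᵥ Pi.single q (1 : ℂ) = (δ ᵥ* g.M) q := by
    rw [dotProduct_comm, single_dotProduct, one_mul]
  rw [h2] at h1
  exact h1

end AffTest

/-! ## Appending horizontal derivatives to a system -/

namespace AffSystem

variable (S : AffSystem n) (U V : Vec n)

/-- `S` together with the horizontal derivatives of all its tests along `(U,V)` (one forward-AD pass). -/
def happend : AffSystem n := ⟨S.m + S.m, Fin.append S.test fun i => (S.test i).hderiv U V⟩

/-- The old tests. -/
theorem happend_test_left (i : Fin S.m) : (S.happend U V).test (Fin.castAdd S.m i) = S.test i := by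
  show Fin.append S.test (fun i => (S.test i).hderiv U V) (Fin.castAdd S.m i) = _
  rw [Fin.append_left]

/-- The appended derivatives. -/
theorem happend_test_right (i : Fin S.m) :
    (S.happend U V).test (Fin.natAdd S.m i) = (S.test i).hderiv U V := by
  show Fin.append S.test (fun i => (S.test i).hderiv U V) (Fin.natAdd S.m i) = _
  rw [Fin.append_right]

variable {S U V}

/-- Appending horizontal derivatives keeps a correct system correct (they vanish on the graph). -/
theorem Correct.happend (hC : S.Correct) (U V : Vec n) : (S.happend U V).Correct := by
  intro A B C h
  refine hC A B C fun i => ?_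
  rw [← happend_test_left S U V i]
  exact h _

/-- The kernel after appending: `K' = K ∩ {δ : ⟨J_{∂g_i}, δ⟩ = 0 ∀ i}`. -/
theorem isKer_happend_iff {A B δ : Vec n} :
    (S.happend U V).IsKer A B δ ↔
      S.IsKer A B δ ∧ ∀ i, ((S.test i).hderiv U V).jac A B ⬝ᵥ δ = 0 := by
  constructor
  · intro h
    refine ⟨fun i => ?_, fun i => ?_⟩
    · have := h (Fin.castAdd S.m i)
      rwa [happend_test_left] at this
    · have := h (Fin.natAdd S.m i)
      rwa [happend_test_right] at this
  · rintro ⟨hK, hH⟩ j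
    induction j using Fin.addCases with
    | left i => rw [happend_test_left]; exact hK i
    | right i => rw [happend_test_right]; exact hH i

/-- **Full horizontal closure is reduced everywhere (pointwise rigidity).**  A kernel vector of a
correct system at `(A,B)` that is orthogonal to the rows of all SECOND horizontal derivatives of all
tests is `0`. -/
theorem Correct.eq_zero_of_isKer_hclosed₂ (hC : S.Correct) {A B δ : Vec n} (hK : S.IsKer A B δ)
    (h₂ : ∀ i U V U' V', (((S.test i).hderiv U V).hderiv U' V').jac A B ⬝ᵥ δ = 0) : δ = 0 := by
  by_contra hδ
  exact hC.not_isKer_of_common_left_ker hδ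
    (fun i => AffTest.vecMul_M_eq_zero_of_hderiv₂ (h₂ i)) A B hK

/-- **`A`-linear-free systems have horizontal depth `≤ 1` off `det B = 0`.**  A kernel vector of a
correct system without `A`-linear parts, at a base point with `B` invertible, orthogonal to the rows of
the first horizontal derivatives along all `A`-directions, is `0`. -/
theorem Correct.eq_zero_of_isKer_hclosed₁ (hC : S.Correct) (hLA : ∀ i, (S.test i).LA = 0)
    {A B δ : Vec n} (hB : Function.Surjective fun U : Vec n => prodVec U B) (hK : S.IsKer A B δ)
    (h₁ : ∀ i U, ((S.test i).hderiv U 0).jac A B ⬝ᵥ δ = 0) : δ = 0 := by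
  by_contra hδ
  exact hC.not_isKer_of_common_left_ker hδ
    (fun i => AffTest.vecMul_M_eq_zero_of_hderiv₁ (hLA i) hB (h₁ i)) A B hK

end AffSystem

/-! ## Pivot designs have horizontal depth ONE, along the free direction `(𝟙, 0)` -/

namespace PivotDesign

variable (D : PivotDesign n)

/-- The row of the horizontal `(𝟙,0)`-derivative of the slot test at `p = (r,k)`, paired with `δ`:
`−Σ_{q ∈ G(r), q.1 = k} δ_q`. -/
theorem jac_hderiv_slotTestD_dotProduct (p : Fin n × Fin n) (A B δ : Vec n) :
    ((D.slotTestD p).hderiv idFun 0).jac A B ⬝ᵥ δ =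
      -∑ q ∈ D.grp p.1, (if q.1 = p.2 then δ q else 0) := by
  rw [AffTest.jac_hderiv]
  simp only [slotTestD, mulVec_zero, zero_mulVec, add_zero, neg_mulVec, grpOp_mulVec, neg_dotProduct,
    grpVec_dotProduct]
  congr 1
  refine Finset.sum_congr rfl fun q _ => ?_
  simp only [idFun]
  split_ifs <;> simp

/-- Inside the serving group of a pivot `q`, only `q` lies in row `q.1` (cross condition). -/
theorem sum_grp_row_eq {q : Fin n × Fin n} (hq : D.piv q = true) (δ : Vec n) :
    ∑ q' ∈ D.grp (D.srow q), (if q'.1 = q.1 then δ q' else 0) = δ q := by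
  rw [Finset.sum_eq_single_of_mem q (D.mem_grp_self hq)]
  · rw [if_pos rfl]
  · intro q' hq' hne
    rw [if_neg]
    intro h1
    have hc := D.cross q q' hq (D.mem_grp.mp hq').1 (D.mem_grp.mp hq').2 hne
    rw [h1, Prod.mk.eta, hq] at hc
    exact Bool.noConfusion hc

/-- **One horizontal derivative along `(𝟙,0)` unmasks every pivot design at EVERY base point.** -/
theorem reducedAt_happend_id (A B : Vec n) : (D.system.happend idFun 0).ReducedAt A B := by
  intro δ hδ
  obtain ⟨hK, hH⟩ := AffSystem.isKer_happend_iff.mp hδ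
  have hpiv : ∀ q, D.piv q = true → δ q = 0 := fun q hq => by
    have h := hH (flat n (D.srow q, q.1))
    have hns : D.piv (D.srow q, q.1) = false := D.piv_eq_false_of_slot (D.slot_srow q hq)
    rw [system_test, test, if_neg (by simp [hns]), if_pos (D.slot_srow q hq),
      jac_hderiv_slotTestD_dotProduct, neg_eq_zero] at h
    rwa [D.sum_grp_row_eq hq] at h
  rw [D.eq_sum_of_isKer hK]
  exact Finset.sum_eq_zero fun q hq => by rw [hpiv q (D.mem_pivots.mp hq), zero_smul]

/-- … and the derived system is still correct. -/
theorem happend_id_correct : (D.system.happend idFun 0).Correct :=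
  D.system_correct.happend _ _

/-- **Horizontal vs generator unmasking of a design**: ONE appended horizontal derivative per test
(one forward-AD pass, direction of cost `0`) gives reducedness EVERYWHERE, while by generators `|P|`
appended tests are NECESSARY at every base point (`|P| ≥ n^{3/2}/4` for the block designs, M55). -/
theorem horizontal_vs_generators :
    (∀ A B : Vec n, (D.system.happend idFun 0).ReducedAt A B) ∧
      ∀ (qs : List (Fin n × Fin n)) (A B : Vec n), (D.system.appendCoord qs).ReducedAt A B →
        Fintype.card {q // D.piv q = true} ≤ qs.length :=
  ⟨D.reducedAt_happend_id, fun _ _ _ h => D.card_piv_le_length_of_unmask h⟩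

/-- The block instance: on `n = 2h·2h`, ONE horizontal pass unmasks `block (2h) h` everywhere, while
`≥ 2h³` generators are needed. -/
theorem block_horizontal_vs_generators (h : ℕ) :
    (∀ A B, ((block (2 * h) h).system.happend idFun 0).ReducedAt A B) ∧
      ∀ (qs : List (Fin (2 * h * (2 * h)) × Fin (2 * h * (2 * h)))) (A B : Vec (2 * h * (2 * h))),
        ((block (2 * h) h).system.appendCoord qs).ReducedAt A B → 2 * h * h * h ≤ qs.length := by
  refine ⟨(block (2 * h) h).reducedAt_happend_id, fun qs A B hred => ?_⟩
  have h1 := (block (2 * h) h).card_piv_le_length_of_unmask hred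
  have h2 := block_card (m := 2 * h) (h := h) (by omega)
  have h3 : 2 * h - h = h := by omega
  rw [h3] at h2
  calc 2 * h * h * h = 2 * h * h * h := rfl
    _ ≤ Fintype.card {q // (block (2 * h) h).piv q = true} := h2
    _ ≤ qs.length := h1

end PivotDesign

end Summit.MatrixMultiplication.MatrixMultiplication.Theorems.GraphEquations

end
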